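import Mathlib
import Summits.Ventures.DiscreteObjects.Mahler.FourTermMeasureBound
import Summits.Ventures.DiscreteObjects.Mahler.ReciprocalTrinomialMeasureBound
import Summits.Ventures.DiscreteObjects.Mahler.SmythTheorem
import Summits.Ventures.DiscreteObjects.Mahler.SubLehmerStructure

/-!
# Every cyclotomic-free integer polynomial with at most four monomials has `M ≥ θ₀`; a sub-Lehmer
polynomial has at least five monomials (venture `DiscreteObjects`, target L)

Cell `pub-namedobj`, seat `pub-namedobj-mahler-g24`. Framing: lottery ticket; floor = certified
bounds/negative ranges.

* `sqrt_two_le_measure_of_reciprocal_of_card_support_le_four` — a cyclotomic-free reciprocal or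
  antireciprocal `P ∈ ℤ[X]` (`P.reverse = ± P`) with `P(0) ≠ 0`, `deg P ≥ 1` and at most four nonzero
  coefficients has `M(P) ≥ √2`: by the classification of its support it is `±(xⁿ ± 1)` (excluded),
  `±(x^{2m} + c x^m + 1)` or `±(x^{p+q} + b x^p + s b x^q + s)`, or has leading coefficient `≥ 2` in
  modulus (`FourTermMeasureBound`, `ReciprocalTrinomialMeasureBound`);
* `smythTheta_le_measure_of_cyclotomicFree_card_support_le_four` — **every cyclotomic-free `P ∈ ℤ[X]` with `P(0) ≠ 0`,
  `deg P ≥ 1` and at most four monomials has `M(P) ≥ θ₀ = 1.3247…`** (Smyth's theorem,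
  `intMahlerMeasure_ge_smythTheta_of_nonreciprocal`, for the nonreciprocal ones); sharp: `x³ - x - 1`;
  in print without the cyclotomic-free hypothesis: [Dobrowolski2006, Prop. 2];
* `five_le_card_support_of_subLehmer` / `five_le_card_support_of_irreducible_subLehmer` — **a
  cyclotomic-free (in particular an irreducible) sub-Lehmer polynomial has at least five monomials**;
* `intMahlerMeasure_lehmer_pentanomial` — and five is attained AT Lehmer's measure:
  `M(x¹² - x⁷ - x⁶ - x⁵ + 1) = M(ℓ)`, since `x¹² - x⁷ - x⁶ - x⁵ + 1 = ℓ(x) · Φ₆(x)`.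

Census reading (cell `pub-namedobj`, target L): the Lehmer ticket lives among polynomials with at least
five monomials, and the sparsest known polynomial of measure `M(ℓ)` has exactly five.  IN PRINT
(REPLICATION / kernel formalisation): [Dobrowolski2006] E. Dobrowolski, Acta Arith. 123 (2006), Prop. 2 — a
monic quadrinomial with `f(0) ≠ 0` that is not a product of cyclotomic polynomials has `M(f) ≥ θ₀` (sharp,
`(x - 1)(x³ - x - 1)`); the cyclotomic-free statement below is the part of that result obtainable without the
finite numerical check of its proof.  See also Dobrowolski–Smyth, IJNT 13 (2017), Thm 1 (`M ≥ h/4`).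
-/

namespace Summit.Ventures.DiscreteObjects.Mahler

open Polynomial

/-! ### Support classification of sparse (anti)reciprocal polynomials -/

/-- **Monic case.**  Let `P ∈ ℤ[X]` be monic of degree `n ≥ 1`, cyclotomic-free, with at most four
nonzero coefficients, and (anti)reciprocal in coefficient form: `P_{n-i} = ε P_i` (`ε = ±1`).  Then
`M(P) ≥ √2`.  (Support `{0, n}`: `P = xⁿ + ε`, not cyclotomic-free; `{0, m, n}`: `n = 2m`, `ε = 1`,
`P = x^{2m} + c x^m + 1`; `{0, p, q, n}`: `q = n - p`, `P = x^{p+q} + b x^p + ε b x^q + ε`.) -/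
theorem sqrt_two_le_measure_of_monic_reciprocal_sparse {P : ℤ[X]} {ε : ℤ} (hε : ε = 1 ∨ ε = -1)
    (hmon : P.Monic) (hdeg : 0 < P.natDegree)
    (hrel : ∀ i ≤ P.natDegree, P.coeff (P.natDegree - i) = ε * P.coeff i)
    (hcf : ∀ k : ℕ, 0 < k → ¬ cyclotomic k ℤ ∣ P) (hcard : P.support.card ≤ 4) :
    Real.sqrt 2 ≤ intMahlerMeasure P := by
  set n := P.natDegree with hn
  have hεε : ε * ε = 1 := by rcases hε with h | h <;> simp [h]
  have hε0 : ε ≠ 0 := by rcases hε with h | h <;> simp [h]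
  have hcn : P.coeff n = 1 := hmon.coeff_natDegree
  have hc0 : P.coeff 0 = ε := by
    have h := hrel 0 (Nat.zero_le _)
    rw [Nat.sub_zero, hcn] at h
    linear_combination (-ε) * h + (-(P.coeff 0)) * hεε
  -- the inner support `S = support \ {0, n}`
  set S := (P.support.erase n).erase 0 with hS
  have hmemS : ∀ k, k ∈ S ↔ k ≠ 0 ∧ k ≠ n ∧ P.coeff k ≠ 0 := by
    intro k; simp only [hS, Finset.mem_erase, mem_support_iff]
  have hScard : S.card ≤ 2 := by
    have h1 : n ∈ P.support := mem_support_iff.mpr (by rw [hcn]; exact one_ne_zero)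
    have h2 : 0 ∈ P.support.erase n := Finset.mem_erase.mpr ⟨by omega, mem_support_iff.mpr (by rw [hc0]; exact hε0)⟩
    have e1 : S.card = (P.support.erase n).card - 1 := Finset.card_erase_of_mem h2
    have e2 : (P.support.erase n).card = P.support.card - 1 := Finset.card_erase_of_mem h1
    omega
  have hzero : ∀ k, k ∉ S → k ≠ 0 → k ≠ n → P.coeff k = 0 := by
    intro k hk hk0 hkn
    by_contra h
    exact hk ((hmemS k).mpr ⟨hk0, hkn, h⟩)
  have hsymm : ∀ k ∈ S, n - k ∈ S := by
    intro k hk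
    obtain ⟨hk0, hkn, hkc⟩ := (hmemS k).mp hk
    have hkle : k ≤ n := le_natDegree_of_ne_zero hkc
    refine (hmemS _).mpr ⟨by omega, by omega, ?_⟩
    rw [hrel k hkle]
    exact mul_ne_zero hε0 hkc
  have hS3 : S.card = 0 ∨ S.card = 1 ∨ S.card = 2 := by omega
  rcases hS3 with h0 | h1 | h2
  · -- `P = xⁿ + ε`: vanishes at `α` with `αⁿ = -ε`, a root of unity — contradiction
    exfalso
    have hSe : S = ∅ := Finset.card_eq_zero.mp h0
    have hP : P = X ^ n + C ε := by
      ext k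
      simp only [coeff_add, coeff_X_pow, coeff_C]
      by_cases hk0 : k = 0
      · subst hk0; rw [if_neg (by omega), if_pos rfl, hc0, zero_add]
      by_cases hkn : k = n
      · subst hkn; rw [if_pos rfl, if_neg hk0, hcn, add_zero]
      rw [if_neg hkn, if_neg hk0, add_zero]
      exact hzero k (by rw [hSe]; exact Finset.notMem_empty k) hk0 hkn
    obtain ⟨α, hα⟩ := IsAlgClosed.exists_pow_nat_eq (-(ε : ℂ)) hdeg
    refine pow_ne_one_of_cyclotomicFree hcf (α := α) ?_ (show 0 < 2 * n by omega) ?_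
    · rw [hP]
      simp only [map_add, map_pow, aeval_X, eq_intCast, map_intCast, hα]
      ring
    · rw [pow_mul', hα, neg_sq]
      have : (ε : ℂ) * ε = 1 := by exact_mod_cast hεε
      linear_combination this
  · -- `S = {m}`: `n = 2m`, `ε = 1`, `P = x^{2m} + c x^m + 1`
    obtain ⟨m, hSm⟩ := Finset.card_eq_one.mp h1
    have hmS : m ∈ S := by rw [hSm]; exact Finset.mem_singleton_self m
    obtain ⟨hm0, hmn, hmc⟩ := (hmemS m).mp hmS
    have hmle : m ≤ n := le_natDegree_of_ne_zero hmc
    have hnm : n - m = m := by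
      have h := hsymm m hmS
      rw [hSm, Finset.mem_singleton] at h
      exact h
    have hn2 : n = 2 * m := by omega
    have hmpos : 0 < m := Nat.pos_of_ne_zero hm0
    -- `ε = 1`, since `P_{n-m} = ε P_m` reads `c = ε c` with `c ≠ 0`
    have hε1 : ε = 1 := by
      rcases hε with h | h
      · exact h
      · exfalso
        have h2 := hrel m hmle
        rw [hnm, h] at h2
        have : P.coeff m = 0 := by linarith
        exact hmc this
    set c := P.coeff m with hc
    have hP : P = X ^ (2 * m) + C c * X ^ m + C 1 := by
      ext k
      simp only [coeff_add, coeff_X_pow, coeff_C_mul, coeff_C]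
      by_cases hk0 : k = 0
      · subst hk0
        rw [if_neg (by omega), if_neg (by omega), if_pos rfl, hc0, hε1]; ring
      by_cases hkn : k = 2 * m
      · subst hkn
        rw [if_pos rfl, if_neg (by omega), if_neg (by omega), ← hn2, hcn]; ring
      by_cases hkm : k = m
      · subst hkm
        rw [if_neg hkn, if_pos rfl, if_neg hk0]; ring
      rw [if_neg hkn, if_neg hkm, if_neg hk0]
      have : k ∉ S := by rw [hSm, Finset.mem_singleton]; exact hkm
      rw [hzero k this hk0 (by omega)]; ring
    rw [hP] at hcf ⊢
    exact sqrt_two_le_measure_trinomial hmpos hcf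
  · -- `S = {i, j}`, `i < j`: `j = n - i`, `P = x^{i+j} + b x^i + ε b x^j + ε`
    obtain ⟨i, j, hij, hSij⟩ := Finset.card_eq_two.mp h2
    wlog hlt : i < j generalizing i j
    · exact this j i hij.symm (by rw [hSij, Finset.pair_comm]) (by omega)
    have hiS : i ∈ S := by rw [hSij]; simp
    have hjS : j ∈ S := by rw [hSij]; simp
    obtain ⟨hi0, hin, hic⟩ := (hmemS i).mp hiS
    obtain ⟨hj0, hjn, hjc⟩ := (hmemS j).mp hjS
    have hile : i ≤ n := le_natDegree_of_ne_zero hic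
    have hjle : j ≤ n := le_natDegree_of_ne_zero hjc
    have h1 := hsymm i hiS
    have h2' := hsymm j hjS
    rw [hSij, Finset.mem_insert, Finset.mem_singleton] at h1 h2'
    have hnij : n = i + j := by omega
    have hipos : 0 < i := Nat.pos_of_ne_zero hi0
    set b := P.coeff i with hb
    have hcj : P.coeff j = ε * b := by
      have h := hrel i hile
      rwa [show n - i = j by omega] at h
    have hP : P = X ^ (i + j) + C b * X ^ i + C (ε * b) * X ^ j + C ε := by
      ext k
      simp only [coeff_add, coeff_X_pow, coeff_C_mul, coeff_C]
      by_cases hk0 : k = 0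
      · subst hk0
        rw [if_neg (by omega), if_neg (by omega), if_neg (by omega), if_pos rfl, hc0]; ring
      by_cases hkn : k = i + j
      · subst hkn
        rw [if_pos rfl, if_neg (by omega), if_neg (by omega), if_neg (by omega), ← hnij, hcn]; ring
      by_cases hki : k = i
      · subst hki
        rw [if_neg hkn, if_pos rfl, if_neg (by omega), if_neg hk0]; ring
      by_cases hkj : k = j
      · subst hkj
        rw [if_neg hkn, if_neg (by omega), if_pos rfl, if_neg hk0, hcj]; ring
      rw [if_neg hkn, if_neg hki, if_neg hkj, if_neg hk0]
      have : k ∉ S := by rw [hSij, Finset.mem_insert, Finset.mem_singleton]; exact not_or.mpr ⟨hki, hkj⟩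
      rw [hzero k this hk0 (by omega)]; ring
    rw [hP] at hcf ⊢
    exact sqrt_two_le_measure_quadrinomial hipos hlt hε hcf

/-- **A cyclotomic-free (anti)reciprocal integer polynomial with at most four monomials has `M ≥ √2`.**
Here (anti)reciprocal means `P.reverse = P` or `P.reverse = -P`, and we assume `P(0) ≠ 0`, `deg P ≥ 1`. -/
theorem sqrt_two_le_measure_of_reciprocal_of_card_support_le_four {P : ℤ[X]}
    (hrev : P.reverse = P ∨ P.reverse = -P) (h0 : P.coeff 0 ≠ 0) (hdeg : 0 < P.natDegree)
    (hcf : ∀ k : ℕ, 0 < k → ¬ cyclotomic k ℤ ∣ P) (hcard : P.support.card ≤ 4) :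
    Real.sqrt 2 ≤ intMahlerMeasure P := by
  have hP0 : P ≠ 0 := fun h => h0 (by simp [h])
  -- the coefficient form of (anti)reciprocity
  obtain ⟨ε, hε, hrel⟩ : ∃ ε : ℤ, (ε = 1 ∨ ε = -1) ∧
      ∀ i ≤ P.natDegree, P.coeff (P.natDegree - i) = ε * P.coeff i := by
    rcases hrev with h | h
    · refine ⟨1, Or.inl rfl, fun i hi => ?_⟩
      have hc := congrArg (fun Q : ℤ[X] => Q.coeff i) h
      simp only [coeff_reverse, revAt_le hi] at hc
      rw [hc, one_mul]
    · refine ⟨-1, Or.inr rfl, fun i hi => ?_⟩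
      have hc := congrArg (fun Q : ℤ[X] => Q.coeff i) h
      simp only [coeff_reverse, revAt_le hi, coeff_neg] at hc
      rw [hc]; ring
  -- leading coefficient `± 1`, else `M ≥ 2`
  by_cases hlc : 2 ≤ |P.leadingCoeff|
  · have h := abs_leadingCoeff_le_intMahlerMeasure P
    have : (2 : ℝ) ≤ |(P.leadingCoeff : ℝ)| := by exact_mod_cast hlc
    have hs2 : Real.sqrt 2 ≤ 2 := by
      rw [show (2 : ℝ) = Real.sqrt (2 ^ 2) by rw [Real.sqrt_sq (by norm_num)]]
      exact Real.sqrt_le_sqrt (by norm_num)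
    linarith
  have hlc1 : P.leadingCoeff = 1 ∨ P.leadingCoeff = -1 := by
    have hne : P.leadingCoeff ≠ 0 := leadingCoeff_ne_zero.mpr hP0
    have hnn := abs_nonneg P.leadingCoeff
    rcases abs_choice P.leadingCoeff with h | h <;> rw [h] at hlc hnn <;> omega
  rcases hlc1 with h1 | h1
  · exact sqrt_two_le_measure_of_monic_reciprocal_sparse hε h1 hdeg hrel hcf hcard
  · -- pass to `-P`
    have hmon : (-P).Monic := by rw [Monic, leadingCoeff_neg, h1, neg_neg]
    rw [← intMahlerMeasure_neg]
    refine sqrt_two_le_measure_of_monic_reciprocal_sparse (ε := ε) hε hmon (by rwa [natDegree_neg]) ?_ ?_ ?_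
    · intro i hi
      rw [natDegree_neg] at hi ⊢
      rw [coeff_neg, coeff_neg, hrel i hi]; ring
    · intro k hk hdvd
      exact hcf k hk ((dvd_neg).mp hdvd)
    · rwa [support_neg]

/-- **Every cyclotomic-free integer polynomial with at most four monomials has `M ≥ θ₀ = 1.3247…`**
(`P(0) ≠ 0`, `deg P ≥ 1`).  Nonreciprocal `P`: Smyth's theorem; (anti)reciprocal `P`: `M ≥ √2 > θ₀`.
Sharp: `M(x³ - x - 1) = θ₀` (`MahlerMeasureCompXPow.smyth_bound_attained`). -/
theorem smythTheta_le_measure_of_cyclotomicFree_card_support_le_four {P : ℤ[X]} (h0 : P.coeff 0 ≠ 0)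
    (hdeg : 0 < P.natDegree) (hcf : ∀ k : ℕ, 0 < k → ¬ cyclotomic k ℤ ∣ P)
    (hcard : P.support.card ≤ 4) : smythTheta ≤ intMahlerMeasure P := by
  by_cases hrev : P.reverse = P ∨ P.reverse = -P
  · have h := sqrt_two_le_measure_of_reciprocal_of_card_support_le_four hrev h0 hdeg hcf hcard
    have h2 : (13248 : ℝ) / 10000 < Real.sqrt 2 := by
      rw [Real.lt_sqrt (by norm_num)]; norm_num
    linarith [smythTheta_lt]
  · obtain ⟨h1, h2⟩ := not_or.mp hrev
    exact intMahlerMeasure_ge_smythTheta_of_nonreciprocal h0 h1 h2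

/-- **A cyclotomic-free sub-Lehmer polynomial with nonzero constant term has at least five monomials.** -/
theorem five_le_card_support_of_subLehmer {P : ℤ[X]} (h0 : P.coeff 0 ≠ 0)
    (hcf : ∀ k : ℕ, 0 < k → ¬ cyclotomic k ℤ ∣ P) (hP : SubLehmer P) : 5 ≤ P.support.card := by
  by_contra hlt
  have hcard : P.support.card ≤ 4 := by omega
  have hL := lehmer_measure_upper_bound
  obtain ⟨h1, h2⟩ := hP
  rcases Nat.eq_zero_or_pos P.natDegree with hd | hd
  · -- constant polynomial: `M = |P(0)|` is an integer `> 1`, hence `≥ 2`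
    have hC := eq_C_of_natDegree_eq_zero hd
    rw [hC, intMahlerMeasure_C] at h1 h2
    have h3 : (2 : ℝ) ≤ |(P.coeff 0 : ℝ)| := by
      have h1' : (1 : ℤ) < |P.coeff 0| := by exact_mod_cast h1
      have : (2 : ℤ) ≤ |P.coeff 0| := h1'
      exact_mod_cast this
    linarith
  · have h := smythTheta_le_measure_of_cyclotomicFree_card_support_le_four h0 hd hcf hcard
    linarith [smythTheta_gt]

/-- **An irreducible sub-Lehmer polynomial has at least five monomials.**  (An irreducible `P` with
`1 < M(P)` has `P(0) ≠ 0` and no cyclotomic factor.) -/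
theorem five_le_card_support_of_irreducible_subLehmer {P : ℤ[X]} (hirr : Irreducible P) (hP : SubLehmer P) :
    5 ≤ P.support.card :=
  five_le_card_support_of_subLehmer (core_coeff_zero_ne_zero hirr hP)
    (fun _ hk => core_not_cyclotomic_dvd hirr hP hk) hP

/-- **Five monomials are attained at Lehmer's measure:** `x¹² - x⁷ - x⁶ - x⁵ + 1 = ℓ(x)·(x² - x + 1)` with
`x² - x + 1 = Φ₆`, so `M(x¹² - x⁷ - x⁶ - x⁵ + 1) = M(ℓ) = 1.17628…`. -/
theorem intMahlerMeasure_lehmer_pentanomial :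
    intMahlerMeasure (X ^ 12 - X ^ 7 - X ^ 6 - X ^ 5 + 1 : ℤ[X]) = intMahlerMeasure lehmerPoly := by
  have hfac : (X ^ 12 - X ^ 7 - X ^ 6 - X ^ 5 + 1 : ℤ[X]) = lehmerPoly * cyclotomic 6 ℤ := by
    rw [cyclotomic_six]; unfold lehmerPoly; ring
  rw [hfac, intMahlerMeasure_mul, intMahlerMeasure_cyclotomic, mul_one]

end Summit.Ventures.DiscreteObjects.Mahler
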